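import Summits.CriticalPhenomena.PercolationContinuityZ3.Theorems.Transplant.FKConnectivityAllQCondClusterDomDefs
import HarnessLib

/-!
# Connectivity correlation inequalities for `φ_{w,q}`, every `q > 0` — CONDITIONAL cluster monotonicity in an adjacent edge
# (two conjecture nodes) IMPLIES the conditioned hub inequality and two-arm negative correlation, hence the four-point inequality
# and Kozma–Nitzan additive gluing for relay sets of size `≤ 2`

Support file (`--supports stmt-CriticalPhenomena-4575`), FK sub-lane `prim-bschramm-fk-1` (gen 8) of the post-continuity
programme; builds on p205010 (kernel theorem, internal audit signed; external expert review pending).  No definitions (the two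
nodes live in `…CondClusterDomDefs.lean`), no named facts, no sorries; standard axioms.

The companion file `…ClusterDomAssoc` proves MM ⇒ CA by Harris' induction on the pairs at the cluster.  The same induction run
under the conditioning `{x ↮ c}` needs two monotonicity inputs, recorded here as conjecture nodes (exact census fk-1 g8: 0 violations,
all up-sets, random weighted graphs on `≤ 6` vertices, `q ∈ {1/10, 1/2, 9/10, 1, 3/2, 2, 3}`):
* (MMc⁺, `CondClusterDomAdjOn`) for a pair `f = xz` at `x` and a third vertex `c`, the law of `C_x` GIVEN `{x ↮ c}` is stochastically
  larger when `f` is open than when `f` is closed: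
  `φ_{w[f↦0]}(C_x ∈ 𝒰, x ↮ c)·φ_{w[f↦1]}(x ↮ c) ≤ φ_{w[f↦1]}(C_x ∈ 𝒰, x ↮ c)·φ_{w[f↦0]}(x ↮ c)`;
* (MMc⁻, `CrossClusterAntiAdjOn`) under the same conditioning the law of the OTHER cluster `C_c` is stochastically smaller when `f` is
  open: `φ_{w[f↦1]}(C_c ∈ 𝒱, x ↮ c)·φ_{w[f↦0]}(x ↮ c) ≤ φ_{w[f↦0]}(C_c ∈ 𝒱, x ↮ c)·φ_{w[f↦1]}(x ↮ c)`.
THEOREMS (every `q > 0`, Harris' induction under conditioning; the cross term is `(d₁a₀ − d₀a₁)(d₁b₀ − d₀b₁)` with the signs of the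
two brackets supplied by the nodes): `hubCondUnder_of_condClusterDomAdjOn` (MMc⁺ ⇒ vdBHK Thm 1.3-shape `HubCondUnder` for `φ_{w,q}`),
`twoArmNegUnder_of_cond` (MMc⁺ ∧ MMc⁻ ⇒ vdBHK Thm 1.4-shape `TwoArmNegUnder`); with fk-1 g4's `fourPointFKPos_of` and
`additiveGluingTwoFKPos_of`: `CondClusterDomAdjFKPos ∧ CrossClusterAntiAdjFKPos → FourPointFKPos → AdditiveGluingTwoFKPos` — the
`|A| ≤ 2` slice of Kozma–Nitzan additive gluing for every `q ∈ (0,1)` from two single-edge monotonicity statements.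
At `q = 1` both nodes follow from van den Berg–Kahn's one-cluster conditional association and the Markov property (memo
bschramm/FROM-fk-1-g8-*.md §2); they are recorded for all `q > 0` and NOT asserted.
[cite: VandenbergHaggstromKahn2005, Thms. 1.3, 1.4 (pp. 6–7)] [cite: KozmaNitzan2024, Thm. 1, proof (pp. 7–8); Conj. 1 (p. 3)]
[cite: Grimmett2006, Thm. (2.19) proof (pp. 26–27); Thm. (3.7) (p. 39); §3.9 (pp. 63–65)]
-/

noncomputable section

namespace Summit.CriticalPhenomena.PercolationContinuityZ3.Theorems

namespace FK

open MeasureTheory Set Literature.Probability.LatticeModels Literature.Probability.Percolation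
open scoped Classical
open BHK2006 DecisionTree HullPort

variable {V : Type*} [Fintype V]

/-! ### MMc⁺ ⇒ the conditioned hub inequality -/

/-- **MMc⁺ ⇒ conditional association of the cluster given `{x ↮ c}`, inductive form.** [cite: VandenbergHaggstromKahn2005, Thm. 1.3 (p. 6)]
[cite: Grimmett2006, Thm. (2.19) proof (pp. 26–27); Thm. (3.7) (p. 39)] -/
theorem condAssoc_aux {q : ℝ} (hq0 : 0 < q) (h : CondClusterDomAdjOn V q) (c : V) :
    ∀ (n : ℕ) (w : Sym2 V → unitInterval), (undet w).card = n → ∀ (x : V) (𝒰 𝒱 : Set (Set V)),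
      IsUpperSet 𝒰 → IsUpperSet 𝒱 →
        (rcMeasureW w q ∅).real (clusterIn x 𝒰 ∩ sepEv x c) * (rcMeasureW w q ∅).real (clusterIn x 𝒱 ∩ sepEv x c) ≤
          (rcMeasureW w q ∅).real (sepEv x c) * (rcMeasureW w q ∅).real (clusterIn x 𝒰 ∩ clusterIn x 𝒱 ∩ sepEv x c) := by
  intro n
  induction n using Nat.strong_induction_on with
  | _ n ih =>
    intro w hn x 𝒰 𝒱 h𝒰 h𝒱
    by_cases hcase : ∃ f ∈ cut {x} (oneSet w), f ∈ undet w
    · obtain ⟨f, ⟨v, hvf, x', hx', hxv⟩, hfu⟩ := hcase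
      rw [mem_singleton_iff] at hx'
      subst hx'
      have hf : f = s(v, Sym2.Mem.other hvf) := (Sym2.other_spec hvf).symm
      set b := Sym2.Mem.other hvf with hb
      have hw1 : w f ≠ 1 := fun h1 => (mem_undet_iff w f).1 hfu (Or.inr h1)
      have reach : ∀ bb : Bool, (openGraph (oneSet (setW w f bb))).Reachable x' v := fun bb =>
        hxv.mono (openGraph_le (oneSet_subset_oneSet_setW w hw1 bb))
      have hlt : ∀ bb : Bool, (undet (setW w f bb)).card < n := fun bb => by
        have h1 := card_undet_setW_le w hfu bb
        have hpos : 0 < (undet w).card := Finset.card_pos.2 ⟨f, hfu⟩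
        omega
      have ih1 := ih _ (hlt true) (setW w f true) rfl x' 𝒰 𝒱 h𝒰 h𝒱
      have ih0 := ih _ (hlt false) (setW w f false) rfl x' 𝒰 𝒱 h𝒰 h𝒱
      -- MMc⁺ at `v`, transported to `x'`
      have mm : ∀ 𝒲 : Set (Set V), IsUpperSet 𝒲 →
          (rcMeasureW (setW w f true) q ∅).real (sepEv x' c) * (rcMeasureW (setW w f false) q ∅).real (clusterIn x' 𝒲 ∩ sepEv x' c) ≤
          (rcMeasureW (setW w f false) q ∅).real (sepEv x' c) * (rcMeasureW (setW w f true) q ∅).real (clusterIn x' 𝒲 ∩ sepEv x' c) := by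
        intro 𝒲 h𝒲
        have e1 := real_clusterIn_inter_inter_sepEv_eq (setW w f true) hq0 (reach true) 𝒲 Set.univ c
        have e0 := real_clusterIn_inter_inter_sepEv_eq (setW w f false) hq0 (reach false) 𝒲 Set.univ c
        simp only [Set.inter_univ] at e1 e0
        have d1 := real_inter_sepEv_eq (setW w f true) hq0 (reach true) Set.univ c
        have d0 := real_inter_sepEv_eq (setW w f false) hq0 (reach false) Set.univ c
        simp only [Set.univ_inter] at d1 d0
        rw [e1, e0, d1, d0, setW_false_eq, setW_true_eq, hf]
        have key := h w v b c 𝒲 h𝒲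
        linarith [key]
      haveI i1 := isProbabilityMeasure_rcMeasureW (setW w f true) hq0 (∅ : Set V)
      haveI i0 := isProbabilityMeasure_rcMeasureW (setW w f false) hq0 (∅ : Set V)
      rw [real_opd w hq0 f (clusterIn x' 𝒰 ∩ sepEv x' c), real_opd w hq0 f (clusterIn x' 𝒱 ∩ sepEv x' c),
        real_opd w hq0 f (sepEv x' c), real_opd w hq0 f (clusterIn x' 𝒰 ∩ clusterIn x' 𝒱 ∩ sepEv x' c)]
      exact cond_assoc_step (popen_nonneg w hq0 f) (popen_le_one w hq0 f)
        measureReal_nonneg measureReal_nonneg measureReal_nonneg measureReal_nonneg measureReal_nonneg measureReal_nonneg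
        (measureReal_mono Set.inter_subset_right (measure_ne_top _ _))
        (measureReal_mono Set.inter_subset_right (measure_ne_top _ _))
        (measureReal_mono Set.inter_subset_right (measure_ne_top _ _))
        (measureReal_mono Set.inter_subset_right (measure_ne_top _ _))
        ih1 ih0 (mm 𝒰 h𝒰) (mm 𝒱 h𝒱)
    · -- deterministic cluster of `x`
      push Not at hcase
      have hA : ∀ f ∈ cut {x} (oneSet w), w f = 0 ∨ w f = 1 := fun f hf => by
        have := hcase f hf; rw [mem_undet_iff] at this; push Not at this; exact this
      have k𝒰 := fun ω hω => ind_clusterIn_inter_sepEv_const w q x c hA 𝒰 (ω := ω) hω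
      have k𝒱 := fun ω hω => ind_clusterIn_inter_sepEv_const w q x c hA 𝒱 (ω := ω) hω
      have kD := fun ω hω => ind_clusterIn_inter_sepEv_const w q x c hA Set.univ (ω := ω) hω
      rw [clusterIn_univ, Set.univ_inter] at kD
      have eU := real_inter_eq_const_mul w hq0 k𝒰 Set.univ
      have eV := real_inter_eq_const_mul w hq0 k𝒱 Set.univ
      have eD := real_inter_eq_const_mul w hq0 kD Set.univ
      have eUV := real_inter_eq_const_mul w hq0 k𝒰 (clusterIn x 𝒱 ∩ sepEv x c)
      rw [Set.inter_univ] at eU eV eD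
      have hset : clusterIn x 𝒰 ∩ sepEv x c ∩ (clusterIn x 𝒱 ∩ sepEv x c) = clusterIn x 𝒰 ∩ clusterIn x 𝒱 ∩ sepEv x c := by
        ext ω; simp only [Set.mem_inter_iff]; tauto
      rw [hset] at eUV
      rw [eU, eV, eD, eUV, eV]
      -- both sides are products of the same constants
      have hI : ind (clusterIn x 𝒰 ∩ sepEv x c) (oneSet w) * ind (sepEv x c) (oneSet w) = ind (clusterIn x 𝒰 ∩ sepEv x c) (oneSet w) := by
        by_cases h1 : oneSet w ∈ clusterIn x 𝒰 ∩ sepEv x c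
        · rw [ind_of_mem h1, ind_of_mem h1.2]; ring
        · rw [ind_of_not_mem h1]; ring
      have hZ : (rcMeasureW w q ∅).real Set.univ = 1 := by
        haveI := isProbabilityMeasure_rcMeasureW w hq0 (∅ : Set V); exact probReal_univ
      rw [hZ]
      have hI' : ind (clusterIn x 𝒰 ∩ sepEv x c) (oneSet w) * ind (sepEv x c) (oneSet w) *
          ind (clusterIn x 𝒱 ∩ sepEv x c) (oneSet w) =
          ind (clusterIn x 𝒰 ∩ sepEv x c) (oneSet w) * ind (clusterIn x 𝒱 ∩ sepEv x c) (oneSet w) := by rw [hI]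
      nlinarith [hI']

/-- **MMc⁺ ⇒ the conditioned hub inequality** `HubCondUnder (φ_{w,q}) o a b c` (vdBHK Thm 1.3-shape), every `q > 0`.
[cite: VandenbergHaggstromKahn2005, Thm. 1.3 (p. 6)] -/
theorem hubCondUnder_of_condClusterDomAdjOn {q : ℝ} (hq0 : 0 < q) (h : CondClusterDomAdjOn V q)
    (w : Sym2 V → unitInterval) (o a b c : V) : HubCondUnder (rcMeasureW w q ∅) o a b c := by
  unfold HubCondUnder
  have key := condAssoc_aux hq0 h c _ w rfl a {S | o ∈ S} {S | b ∈ S}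
    (SoloBlindKN.isUpperSet_containing o) (SoloBlindKN.isUpperSet_containing b)
  rw [clusterIn_mem_eq_openConn, clusterIn_mem_eq_openConn] at key
  have h1 : (openConn a o : Set (BondConfig V)) = openConn o a := by
    ext ω; exact ⟨fun h => SimpleGraph.Reachable.symm h, fun h => SimpleGraph.Reachable.symm h⟩
  have h2 : (openConn a b : Set (BondConfig V)) = openConn b a := by
    ext ω; exact ⟨fun h => SimpleGraph.Reachable.symm h, fun h => SimpleGraph.Reachable.symm h⟩
  rw [h1, h2] at key
  linarith [key]

/-! ### MMc⁺ ∧ MMc⁻ ⇒ two-arm negative correlation -/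

/-- **MMc⁺ ∧ MMc⁻ ⇒ negative correlation of the clusters of `x` and `c` given `{x ↮ c}`, inductive form** (pairs revealed at the
weight-1 cluster of `x` only). [cite: VandenbergHaggstromKahn2005, Thm. 1.4 (p. 7)] [cite: Grimmett2006, Thm. (3.7) (p. 39)] -/
theorem twoArmNeg_aux {q : ℝ} (hq0 : 0 < q) (h : CondClusterDomAdjOn V q) (h' : CrossClusterAntiAdjOn V q) (c : V)
    (𝒱 : Set (Set V)) (h𝒱 : IsUpperSet 𝒱) :
    ∀ (n : ℕ) (w : Sym2 V → unitInterval), (undet w).card = n → ∀ (x : V) (𝒰 : Set (Set V)), IsUpperSet 𝒰 →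
      (rcMeasureW w q ∅).real (sepEv x c) * (rcMeasureW w q ∅).real (clusterIn x 𝒰 ∩ clusterIn c 𝒱 ∩ sepEv x c) ≤
        (rcMeasureW w q ∅).real (clusterIn x 𝒰 ∩ sepEv x c) * (rcMeasureW w q ∅).real (clusterIn c 𝒱 ∩ sepEv x c) := by
  intro n
  induction n using Nat.strong_induction_on with
  | _ n ih =>
    intro w hn x 𝒰 h𝒰
    by_cases hcase : ∃ f ∈ cut {x} (oneSet w), f ∈ undet w
    · obtain ⟨f, ⟨v, hvf, x', hx', hxv⟩, hfu⟩ := hcase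
      rw [mem_singleton_iff] at hx'
      subst hx'
      have hf : f = s(v, Sym2.Mem.other hvf) := (Sym2.other_spec hvf).symm
      set b := Sym2.Mem.other hvf with hb
      have hw1 : w f ≠ 1 := fun h1 => (mem_undet_iff w f).1 hfu (Or.inr h1)
      have reach : ∀ bb : Bool, (openGraph (oneSet (setW w f bb))).Reachable x' v := fun bb =>
        hxv.mono (openGraph_le (oneSet_subset_oneSet_setW w hw1 bb))
      have hlt : ∀ bb : Bool, (undet (setW w f bb)).card < n := fun bb => by
        have h1 := card_undet_setW_le w hfu bb
        have hpos : 0 < (undet w).card := Finset.card_pos.2 ⟨f, hfu⟩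
        omega
      have ih1 := ih _ (hlt true) (setW w f true) rfl x' 𝒰 h𝒰
      have ih0 := ih _ (hlt false) (setW w f false) rfl x' 𝒰 h𝒰
      have d1 := real_inter_sepEv_eq (setW w f true) hq0 (reach true) Set.univ c
      have d0 := real_inter_sepEv_eq (setW w f false) hq0 (reach false) Set.univ c
      simp only [Set.univ_inter] at d1 d0
      -- MMc⁺ at `v` for `𝒰`, transported
      have mmU : (rcMeasureW (setW w f true) q ∅).real (sepEv x' c) * (rcMeasureW (setW w f false) q ∅).real (clusterIn x' 𝒰 ∩ sepEv x' c) ≤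
          (rcMeasureW (setW w f false) q ∅).real (sepEv x' c) * (rcMeasureW (setW w f true) q ∅).real (clusterIn x' 𝒰 ∩ sepEv x' c) := by
        have e1 := real_clusterIn_inter_inter_sepEv_eq (setW w f true) hq0 (reach true) 𝒰 Set.univ c
        have e0 := real_clusterIn_inter_inter_sepEv_eq (setW w f false) hq0 (reach false) 𝒰 Set.univ c
        simp only [Set.inter_univ] at e1 e0
        rw [e1, e0, d1, d0, setW_false_eq, setW_true_eq, hf]
        have key := h w v b c 𝒰 h𝒰
        linarith [key]
      -- MMc⁻ at `v` for the cluster of `c`, transported (only the separation event moves)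
      have mmV : (rcMeasureW (setW w f false) q ∅).real (sepEv x' c) * (rcMeasureW (setW w f true) q ∅).real (clusterIn c 𝒱 ∩ sepEv x' c) ≤
          (rcMeasureW (setW w f true) q ∅).real (sepEv x' c) * (rcMeasureW (setW w f false) q ∅).real (clusterIn c 𝒱 ∩ sepEv x' c) := by
        have e1 := real_inter_sepEv_eq (setW w f true) hq0 (reach true) (clusterIn c 𝒱) c
        have e0 := real_inter_sepEv_eq (setW w f false) hq0 (reach false) (clusterIn c 𝒱) c
        rw [e1, e0, d1, d0, setW_false_eq, setW_true_eq, hf]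
        have key := h' w v b c 𝒱 h𝒱
        linarith [key]
      haveI i1 := isProbabilityMeasure_rcMeasureW (setW w f true) hq0 (∅ : Set V)
      haveI i0 := isProbabilityMeasure_rcMeasureW (setW w f false) hq0 (∅ : Set V)
      rw [real_opd w hq0 f (clusterIn x' 𝒰 ∩ sepEv x' c), real_opd w hq0 f (clusterIn c 𝒱 ∩ sepEv x' c),
        real_opd w hq0 f (sepEv x' c), real_opd w hq0 f (clusterIn x' 𝒰 ∩ clusterIn c 𝒱 ∩ sepEv x' c)]
      exact cond_neg_step (popen_nonneg w hq0 f) (popen_le_one w hq0 f)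
        measureReal_nonneg measureReal_nonneg measureReal_nonneg measureReal_nonneg measureReal_nonneg measureReal_nonneg
        (measureReal_mono Set.inter_subset_right (measure_ne_top _ _))
        (measureReal_mono Set.inter_subset_right (measure_ne_top _ _))
        (measureReal_mono Set.inter_subset_right (measure_ne_top _ _))
        (measureReal_mono Set.inter_subset_right (measure_ne_top _ _))
        ih1 ih0 mmU mmV
    · -- deterministic cluster of `x`: equality
      push Not at hcase
      have hA : ∀ f ∈ cut {x} (oneSet w), w f = 0 ∨ w f = 1 := fun f hf => by
        have := hcase f hf; rw [mem_undet_iff] at this; push Not at this; exact this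
      have k𝒰 := fun ω hω => ind_clusterIn_inter_sepEv_const w q x c hA 𝒰 (ω := ω) hω
      have kD := fun ω hω => ind_clusterIn_inter_sepEv_const w q x c hA Set.univ (ω := ω) hω
      rw [clusterIn_univ, Set.univ_inter] at kD
      have eU := real_inter_eq_const_mul w hq0 k𝒰 Set.univ
      have eD := real_inter_eq_const_mul w hq0 kD Set.univ
      have eDV := real_inter_eq_const_mul w hq0 kD (clusterIn c 𝒱)
      have eUV := real_inter_eq_const_mul w hq0 k𝒰 (clusterIn c 𝒱)
      rw [Set.inter_univ] at eU eD
      have hset1 : clusterIn x 𝒰 ∩ sepEv x c ∩ clusterIn c 𝒱 = clusterIn x 𝒰 ∩ clusterIn c 𝒱 ∩ sepEv x c := by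
        ext ω; simp only [Set.mem_inter_iff]; tauto
      have hset2 : sepEv x c ∩ clusterIn c 𝒱 = clusterIn c 𝒱 ∩ sepEv x c := Set.inter_comm _ _
      rw [hset1] at eUV
      rw [hset2] at eDV
      rw [eU, eD, eDV, eUV]
      have hI : ind (clusterIn x 𝒰 ∩ sepEv x c) (oneSet w) * ind (sepEv x c) (oneSet w) = ind (clusterIn x 𝒰 ∩ sepEv x c) (oneSet w) := by
        by_cases h1 : oneSet w ∈ clusterIn x 𝒰 ∩ sepEv x c
        · rw [ind_of_mem h1, ind_of_mem h1.2]; ring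
        · rw [ind_of_not_mem h1]; ring
      have hZ : (rcMeasureW w q ∅).real Set.univ = 1 := by
        haveI := isProbabilityMeasure_rcMeasureW w hq0 (∅ : Set V); exact probReal_univ
      rw [hZ]
      nlinarith [hI]

/-- **MMc⁺ ∧ MMc⁻ ⇒ two-arm negative correlation** `TwoArmNegUnder (φ_{w,q}) o a b c` (vdBHK Thm 1.4-shape), every `q > 0`.
[cite: VandenbergHaggstromKahn2005, Thm. 1.4 (p. 7)] -/
theorem twoArmNegUnder_of_cond {q : ℝ} (hq0 : 0 < q) (h : CondClusterDomAdjOn V q) (h' : CrossClusterAntiAdjOn V q)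
    (w : Sym2 V → unitInterval) (o a b c : V) : TwoArmNegUnder (rcMeasureW w q ∅) o a b c := by
  unfold TwoArmNegUnder
  have key := twoArmNeg_aux hq0 h h' c {S | b ∈ S} (SoloBlindKN.isUpperSet_containing b) _ w rfl a {S | o ∈ S}
    (SoloBlindKN.isUpperSet_containing o)
  rw [clusterIn_mem_eq_openConn, clusterIn_mem_eq_openConn] at key
  have h1 : (openConn a o : Set (BondConfig V)) = openConn o a := by
    ext ω; exact ⟨fun h => SimpleGraph.Reachable.symm h, fun h => SimpleGraph.Reachable.symm h⟩
  have h2 : (openConn c b : Set (BondConfig V)) = openConn b c := by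
    ext ω; exact ⟨fun h => SimpleGraph.Reachable.symm h, fun h => SimpleGraph.Reachable.symm h⟩
  rw [h1, h2] at key
  exact key

/-! ### The `q`-families and the conjecture nodes -/

/-- `CondClusterDomAdjFK q → HubCondFK q` (every `q > 0`). [cite: VandenbergHaggstromKahn2005, Thm. 1.3 (p. 6)] -/
theorem hubCondFK_of_condClusterDomAdjFK {q : ℝ} (hq0 : 0 < q) (h : CondClusterDomAdjFK q) : HubCondFK q :=
  fun n w o a b c => hubCondUnder_of_condClusterDomAdjOn hq0 (h n) w o a b c

/-- `CondClusterDomAdjFK q ∧ CrossClusterAntiAdjFK q → TwoArmNegFK q` (every `q > 0`). [cite: VandenbergHaggstromKahn2005, Thm. 1.4 (p. 7)] -/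
theorem twoArmNegFK_of_cond {q : ℝ} (hq0 : 0 < q) (h : CondClusterDomAdjFK q) (h' : CrossClusterAntiAdjFK q) : TwoArmNegFK q :=
  fun n w o a b c => twoArmNegUnder_of_cond hq0 (h n) (h' n) w o a b c

/-- **Conjecture nodes: `CondClusterDomAdjFKPos → HubCondFKPos`.** [cite: VandenbergHaggstromKahn2005, Thm. 1.3 (p. 6)] -/
theorem hubCondFKPos_of_condClusterDomAdjFKPos (h : CondClusterDomAdjFKPos) : HubCondFKPos :=
  fun q hq0 => hubCondFK_of_condClusterDomAdjFK hq0 (h q hq0)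

/-- **Conjecture nodes: `CondClusterDomAdjFKPos ∧ CrossClusterAntiAdjFKPos → TwoArmNegFKPos`.** [cite: VandenbergHaggstromKahn2005, Thm. 1.4 (p. 7)] -/
theorem twoArmNegFKPos_of_cond (h : CondClusterDomAdjFKPos) (h' : CrossClusterAntiAdjFKPos) : TwoArmNegFKPos :=
  fun q hq0 => twoArmNegFK_of_cond hq0 (h q hq0) (h' q hq0)

/-- **Conjecture nodes: the two conditional monotonicity statements give the four-point inequality for every `q > 0`.**
[cite: KozmaNitzan2024, Thm. 1, proof (pp. 7–8)] -/
theorem fourPointFKPos_of_cond (h : CondClusterDomAdjFKPos) (h' : CrossClusterAntiAdjFKPos) : FourPointFKPos :=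
  fourPointFKPos_of (hubCondFKPos_of_condClusterDomAdjFKPos h) (twoArmNegFKPos_of_cond h h')

/-- **Conjecture nodes: … and hence Kozma–Nitzan additive gluing for relay sets of size `≤ 2`, every `q > 0`.**
[cite: KozmaNitzan2024, Conj. 1 (p. 3), Thm. 1 (p. 7)] -/
theorem additiveGluingTwoFKPos_of_cond (h : CondClusterDomAdjFKPos) (h' : CrossClusterAntiAdjFKPos) : AdditiveGluingTwoFKPos :=
  additiveGluingTwoFKPos_of (fourPointFKPos_of_cond h h')

end FK

end Summit.CriticalPhenomena.PercolationContinuityZ3.Theorems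

end
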